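import Mathlib.RingTheory.PowerSeries.Trunc
import Mathlib.Algebra.Polynomial.Identities
import HarnessLib

/-!
# Integrality of the square-root and inverse branches of a power series

Topic `Literature/Computation/Certificates`; namespace `Literature.Computation.Certificates.BranchIntegrality`. The last paper
hypothesis of the Coleman disc tail lemma (`ColemanDiscTailBound.lean`: «the local expansion of the differential has
`p`-integral coefficients for ALL `n`») is, for the discs used by the certified rational-points stack (kind CC of
`pub/certnum/nt/FORMAT-ratpcert-v0.md` §17: `η_i = (x₀+t)ⁱ/(2y(t))` with `y(t) = √f(x₀+t)`, `y(0) = y₀` a `p`-unit), the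
following purely algebraic statement, proved here over any commutative ring `K` and subring `S`
(`K = ℚ_p`, `S = ℤ_p` in the application):

* `coeff_mem_of_mul_self_eq` — if `y² = a` with `a ∈ S⟦X⟧`, `y(0) ∈ S` and `2·y(0)` invertible IN `S`, then EVERY
  coefficient of `y` lies in `S` (the square-root branch computed by Newton/Hensel iteration is integral);
* `coeff_mem_of_mul_eq_one` — if `z·y = 1` with `y ∈ S⟦X⟧` and `y(0)` invertible in `S`, then `z ∈ S⟦X⟧`
  (the inverse branch is integral);
* `coeff_mul_mem`, `coeff_pow_mem`, `coeff_eval₂_mem` — products, powers and polynomial images stay in `S⟦X⟧`;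
* `coeff_mem_of_eval₂_eq` — the IMPLICIT branch: `F(x) = g` with `F ∈ S[x]`, `g ∈ S⟦t⟧`, `x(0) ∈ S`, `F'(x(0))`
  invertible in `S` ⇒ `x ∈ S⟦t⟧` (Weierstrass discs `f(x(t)) = t²`; the disc at infinity `s·h(s) = w²`).

Together: `η_i = (x₀ + X)ⁱ · z` with `z·(2y) = 1` has coefficients in `S` whenever `f` has coefficients in `S`,
`x₀, y₀ ∈ S` and `2y₀ ∈ Sˣ` — exactly the unit checks the exact checker performs («units checked» in its verdicts).
Elementary induction on coefficients; no named fact.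

## References

* J. S. Balakrishnan, R. W. Bradshaw, K. S. Kedlaya, Explicit Coleman integration for hyperelliptic curves,
  ANTS IX, LNCS 6197 (2010), §4 (local coordinates at non-Weierstrass points: `y = √f(x)` by Newton iteration).
  [BalakrishnanBradshawKedlaya2010]
* M. Stoll, Independence of rational points on twists of a given curve, Compositio Math. 142 (2006), §6 proof of
  Prop. 6.3 («ω has an expansion with coefficients in 𝒪»). [Stoll2006IndependenceTwists]
-/

namespace Literature.Computation.Certificates.BranchIntegrality

open PowerSeries Finset

variable {K : Type*} [CommRing K] (S : Subring K)

/-- Products of power series with coefficients in a subring have coefficients in the subring.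
[cite: Stoll2006IndependenceTwists, §6 proof of Prop. 6.3] -/
theorem coeff_mul_mem {y z : K⟦X⟧} (hy : ∀ n, coeff n y ∈ S) (hz : ∀ n, coeff n z ∈ S) (n : ℕ) :
    coeff n (y * z) ∈ S := by
  rw [coeff_mul]
  exact Subring.sum_mem _ fun q _ => Subring.mul_mem _ (hy _) (hz _)

/-- On the antidiagonal of `n + 1`, a pair other than the two extreme ones has both entries `≤ n`. [folklore] -/
private theorem le_of_mem_antidiagonal_erase {n : ℕ} {q : ℕ × ℕ}
    (hq : q ∈ ((antidiagonal (n + 1)).erase (0, n + 1)).erase (n + 1, 0)) : q.1 ≤ n ∧ q.2 ≤ n := by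
  simp only [mem_erase, ne_eq, mem_antidiagonal] at hq
  obtain ⟨h1, h2, h3⟩ := hq
  rcases q with ⟨i, j⟩
  simp only [Prod.mk.injEq, not_and] at h1 h2 h3 ⊢
  omega

/-- **The square-root branch is integral.** If `y * y = a` where every coefficient of `a` lies in the subring
`S`, the constant term `y₀ = y(0)` lies in `S`, and `2·y₀` has an inverse `u ∈ S`, then every coefficient of `y`
lies in `S`: by induction, `2y₀·y_{n+1} = a_{n+1} − Σ_{1 ≤ i ≤ n} yᵢ y_{n+1−i}`.
(Kind CC: `y(t) = √f(x₀+t)` with `y₀` a `p`-unit ⇒ `y ∈ ℤ_p⟦t⟧`.)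
[cite: BalakrishnanBradshawKedlaya2010, §4 (local coordinates, Newton iteration for y)]
[cite: Stoll2006IndependenceTwists, §6 proof of Prop. 6.3] -/
theorem coeff_mem_of_mul_self_eq {a y : K⟦X⟧} (ha : ∀ n, coeff n a ∈ S) (hy : y * y = a)
    (h0 : constantCoeff y ∈ S) {u : K} (hu : u ∈ S) (hunit : u * (2 * constantCoeff y) = 1) :
    ∀ n, coeff n y ∈ S := by
  intro n
  induction n using Nat.strong_induction_on with
  | _ n ih =>
    rcases n with _ | n
    · rw [coeff_zero_eq_constantCoeff_apply]; exact h0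
    · have hc : coeff (n + 1) (y * y) = coeff (n + 1) a := by rw [hy]
      rw [coeff_mul] at hc
      have hmem1 : ((0 : ℕ), n + 1) ∈ antidiagonal (n + 1) := by simp
      have hmem2 : (n + 1, (0 : ℕ)) ∈ (antidiagonal (n + 1)).erase (0, n + 1) := by simp
      rw [← add_sum_erase _ _ hmem1, ← add_sum_erase _ _ hmem2] at hc
      set T := ∑ q ∈ ((antidiagonal (n + 1)).erase (0, n + 1)).erase (n + 1, 0), coeff q.1 y * coeff q.2 y with hT
      have hTS : T ∈ S := by
        refine Subring.sum_mem _ fun q hq => ?_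
        obtain ⟨hq1, hq2⟩ := le_of_mem_antidiagonal_erase hq
        exact Subring.mul_mem _ (ih _ (Nat.lt_succ_of_le hq1)) (ih _ (Nat.lt_succ_of_le hq2))
      simp only at hc
      rw [coeff_zero_eq_constantCoeff_apply] at hc
      -- hc : c₀ * y_{n+1} + (y_{n+1} * c₀ + T) = a_{n+1}
      have key : coeff (n + 1) y = u * (coeff (n + 1) a - T) := by
        have h2 : coeff (n + 1) y * (2 * constantCoeff y) = coeff (n + 1) a - T := by
          rw [← hc]; ring
        calc coeff (n + 1) y = coeff (n + 1) y * (u * (2 * constantCoeff y)) := by rw [hunit, mul_one]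
          _ = u * (coeff (n + 1) y * (2 * constantCoeff y)) := by ring
          _ = u * (coeff (n + 1) a - T) := by rw [h2]
      rw [key]
      exact Subring.mul_mem _ hu (Subring.sub_mem _ (ha _) hTS)

/-- **The inverse branch is integral.** If `z * y = 1` where every coefficient of `y` lies in `S` and the constant
term `y₀` has an inverse `v ∈ S`, then every coefficient of `z` lies in `S`: `y₀ z_{n+1} = −Σ_{i ≤ n} zᵢ y_{n+1−i}`.
(Kind CC: `1/(2y(t)) ∈ ℤ_p⟦t⟧` since `2y₀` is a `p`-unit.)
[cite: BalakrishnanBradshawKedlaya2010, §4 (local coordinates)] [cite: Stoll2006IndependenceTwists, §6 proof of Prop. 6.3] -/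
theorem coeff_mem_of_mul_eq_one {y z : K⟦X⟧} (hy : ∀ n, coeff n y ∈ S) (hzy : z * y = 1)
    {v : K} (hv : v ∈ S) (hunit : v * constantCoeff y = 1) : ∀ n, coeff n z ∈ S := by
  intro n
  induction n using Nat.strong_induction_on with
  | _ n ih =>
    have hc : coeff n (z * y) = coeff n (1 : K⟦X⟧) := by rw [hzy]
    rw [coeff_mul] at hc
    have hmem : (n, (0 : ℕ)) ∈ antidiagonal n := by simp
    rw [← add_sum_erase _ _ hmem] at hc
    set T := ∑ q ∈ (antidiagonal n).erase (n, 0), coeff q.1 z * coeff q.2 y with hT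
    have hTS : T ∈ S := by
      refine Subring.sum_mem _ fun q hq => ?_
      simp only [mem_erase, ne_eq, mem_antidiagonal] at hq
      obtain ⟨hq1, hq2⟩ := hq
      have hlt : q.1 < n := by
        rcases q with ⟨i, j⟩
        simp only [Prod.mk.injEq, not_and] at hq1 hq2 ⊢
        omega
      exact Subring.mul_mem _ (ih _ hlt) (hy _)
    simp only at hc
    rw [coeff_zero_eq_constantCoeff_apply] at hc
    -- hc : z_n * y₀ + T = coeff n 1
    have h1S : coeff n (1 : K⟦X⟧) ∈ S := by
      rw [coeff_one]; split_ifs <;> simp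
    have key : coeff n z = v * (coeff n (1 : K⟦X⟧) - T) := by
      have h2 : coeff n z * constantCoeff y = coeff n (1 : K⟦X⟧) - T := by rw [← hc]; ring
      calc coeff n z = coeff n z * (v * constantCoeff y) := by rw [hunit, mul_one]
        _ = v * (coeff n z * constantCoeff y) := by ring
        _ = v * (coeff n (1 : K⟦X⟧) - T) := by rw [h2]
    rw [key]
    exact Subring.mul_mem _ hv (Subring.sub_mem _ h1S hTS)

/-- **Integrality of the kind-CC local expansions** `η = P · z` with `z · (2y) = 1`, `y² = a`: if `a` and the
polynomial factor `P` have coefficients in `S`, `y₀ ∈ S`, and `2y₀` is invertible in `S` (inverse `u`), then `η`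
has coefficients in `S` — the hypothesis «`n·aₙ ∈ p^{n+v}ℤ_p`» of `ColemanDiscTailBound` then follows for the
antiderivative of `Σ cᵢ ηᵢ` by `StrassmannDiscCert.integral_of_antiderivative`.
[cite: BalakrishnanBradshawKedlaya2010, §4] [cite: Stoll2006IndependenceTwists, §6 proof of Prop. 6.3] -/
theorem coeff_eta_mem {a y z P : K⟦X⟧} (ha : ∀ n, coeff n a ∈ S) (hP : ∀ n, coeff n P ∈ S) (hy : y * y = a)
    (h0 : constantCoeff y ∈ S) {u : K} (hu : u ∈ S) (hunit : u * (2 * constantCoeff y) = 1)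
    (hz : z * (2 * y) = 1) (n : ℕ) : coeff n (P * z) ∈ S := by
  have hyS := coeff_mem_of_mul_self_eq S ha hy h0 hu hunit
  have h2yS : ∀ m, coeff m (2 * y) ∈ S := by
    intro m
    have : (2 : K⟦X⟧) * y = C 2 * y := by simp [map_ofNat]
    rw [this, coeff_C_mul]
    exact Subring.mul_mem _ (ofNat_mem S 2) (hyS m)
  have hc2 : constantCoeff (2 * y) = 2 * constantCoeff y := by rw [map_mul, map_ofNat]
  have hzS := coeff_mem_of_mul_eq_one S h2yS hz hu (by rw [hc2]; exact hunit)
  exact coeff_mul_mem S hP hzS n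


/-! ### The implicit-function branch (Weierstrass discs and the disc at infinity of kind CC)

For a Weierstrass disc the checker solves `f(x(t)) = t²` by Newton iteration from `x(0) = x₀` with `f'(x₀)` a unit, and
at infinity `s·h(s) = w²` with `h(0) = 1`: a POLYNOMIAL equation `F(x(t)) = g(t)` with `F'(x₀)` invertible in `S`. The
solution's coefficients are integral by the same induction, organised through `Polynomial.binomExpansion`
(`F(x̃ + tᴺr) = F(x̃) + F'(x̃)·tᴺr + k·(tᴺr)²`). Appended 2026-08-29 (certnum-nt-1 g4). -/

/-- Powers of a power series with coefficients in `S` have coefficients in `S`.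
[cite: Stoll2006IndependenceTwists, §6 proof of Prop. 6.3] -/
theorem coeff_pow_mem {φ : K⟦X⟧} (hφ : ∀ n, coeff n φ ∈ S) (k n : ℕ) : coeff n (φ ^ k) ∈ S := by
  induction k generalizing n with
  | zero =>
    rw [pow_zero, coeff_one]
    split_ifs <;> simp
  | succ k ih =>
    rw [pow_succ]
    exact coeff_mul_mem S ih hφ n

/-- A polynomial with coefficients in `S`, evaluated (via `C`) at a power series with coefficients in `S`, has
coefficients in `S`. [cite: Stoll2006IndependenceTwists, §6 proof of Prop. 6.3] -/
theorem coeff_eval₂_mem {F : Polynomial K} (hF : ∀ k, F.coeff k ∈ S) {φ : K⟦X⟧} (hφ : ∀ n, coeff n φ ∈ S)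
    (n : ℕ) : coeff n (F.eval₂ (C (R := K)) φ) ∈ S := by
  rw [Polynomial.eval₂_eq_sum_range, map_sum]
  refine Subring.sum_mem _ fun i _ => ?_
  rw [coeff_C_mul]
  exact Subring.mul_mem _ (hF i) (coeff_pow_mem S hφ i n)

/-- **The implicit-function branch is integral.** Let `F ∈ S[x]` (a polynomial with coefficients in the subring
`S`), `g ∈ S⟦t⟧`, and let `x ∈ K⟦t⟧` solve `F(x(t)) = g(t)` with `x(0) = x₀ ∈ S` and `F'(x₀)` invertible in `S`
(inverse `u`). Then every coefficient of `x` lies in `S`: writing `x = x̃ + tᴺr` with `x̃` the truncation below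
degree `N ≥ 1` (integral by induction), `F(x̃ + tᴺr) = F(x̃) + F'(x̃)tᴺr + k t²ᴺ r²`, so the coefficient of `tᴺ`
gives `F'(x₀)·x_N = g_N − [tᴺ]F(x̃) ∈ S`. (Kind CC: Weierstrass discs `f(x(t)) = t²`, `f'(x₀)` a `p`-unit; the disc
at infinity `s·h(s) = w²`, `h(0) = 1`.)
[cite: BalakrishnanBradshawKedlaya2010, §4 (local coordinates at Weierstrass points and at infinity)]
[cite: Stoll2006IndependenceTwists, §6 proof of Prop. 6.3] -/
theorem coeff_mem_of_eval₂_eq {F : Polynomial K} (hF : ∀ k, F.coeff k ∈ S) {x g : K⟦X⟧}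
    (hg : ∀ n, coeff n g ∈ S) (hx : F.eval₂ (C (R := K)) x = g) (h0 : constantCoeff x ∈ S) {u : K} (hu : u ∈ S)
    (hunit : u * (Polynomial.derivative F).eval (constantCoeff x) = 1) : ∀ n, coeff n x ∈ S := by
  intro n
  induction n using Nat.strong_induction_on with
  | _ n ih =>
    rcases n with _ | m
    · rw [coeff_zero_eq_constantCoeff_apply]; exact h0
    · set N := m + 1 with hN
      -- truncation below degree N and the remainder
      set xt : K⟦X⟧ := ((trunc N x : Polynomial K) : K⟦X⟧) with hxt
      set r : K⟦X⟧ := PowerSeries.mk fun j => coeff (j + N) x with hr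
      have hxt_coeff : ∀ j, coeff j xt = if j < N then coeff j x else 0 := by
        intro j; rw [hxt, Polynomial.coeff_coe, coeff_trunc]
      have hxtS : ∀ j, coeff j xt ∈ S := by
        intro j; rw [hxt_coeff]; split_ifs with hj
        · exact ih j hj
        · exact Subring.zero_mem S
      have hsplit : x = xt + X ^ N * r := by
        ext j
        rw [map_add, hxt_coeff, coeff_X_pow_mul']
        by_cases hj : j < N
        · rw [if_pos hj, if_neg (not_le.2 hj), add_zero]
        · rw [if_neg hj, if_pos (not_lt.1 hj), zero_add, hr, coeff_mk, Nat.sub_add_cancel (not_lt.1 hj)]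
      have hxt0 : constantCoeff xt = constantCoeff x := by
        rw [← coeff_zero_eq_constantCoeff_apply, ← coeff_zero_eq_constantCoeff_apply, hxt_coeff, if_pos (by omega)]
      -- binomial expansion of F (coefficients mapped into K⟦X⟧) at xt with increment X^N * r
      set FK : Polynomial K⟦X⟧ := F.map (C (R := K)) with hFK
      obtain ⟨k, hk⟩ := FK.binomExpansion xt (X ^ N * r)
      have hev : FK.eval x = g := by rw [hFK, Polynomial.eval_map, hx]
      rw [hsplit] at hev
      rw [hev] at hk
      -- take the coefficient of X^N
      have hcoef := congrArg (coeff N) hk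
      rw [map_add, map_add] at hcoef
      -- (i) [X^N] F(xt) ∈ S
      have h1 : coeff N (FK.eval xt) ∈ S := by
        rw [hFK, Polynomial.eval_map]; exact coeff_eval₂_mem S hF hxtS N
      -- (ii) [X^N] (F'(xt) * (X^N r)) = F'(x₀) * x_N
      have h2 : coeff N (FK.derivative.eval xt * (X ^ N * r)) = (Polynomial.derivative F).eval (constantCoeff x) * coeff N x := by
        rw [← mul_assoc, mul_comm (FK.derivative.eval xt) (X ^ N), mul_assoc, coeff_X_pow_mul', if_pos le_rfl,
          Nat.sub_self, coeff_zero_eq_constantCoeff_apply, map_mul]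
        congr 1
        · rw [hFK, Polynomial.derivative_map, Polynomial.eval_map, Polynomial.hom_eval₂, hxt0]
          have hcomp : (constantCoeff (R := K)).comp (C (R := K)) = RingHom.id K := by
            ext a; simp
          rw [hcomp]; rfl
        · rw [hr]; simp
      -- (iii) [X^N] (k * (X^N r)^2) = 0
      have h3 : coeff N (k * (X ^ N * r) ^ 2) = 0 := by
        have : k * (X ^ N * r) ^ 2 = X ^ (N + N) * (k * r ^ 2) := by ring
        rw [this, coeff_X_pow_mul', if_neg (by omega)]
      rw [h2, h3, add_zero] at hcoef
      -- hcoef : coeff N g = coeff N (FK.eval xt) + F'(x₀) * x_N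
      have key : coeff N x = u * (coeff N g - coeff N (FK.eval xt)) := by
        have e1 : (Polynomial.derivative F).eval (constantCoeff x) * coeff N x = coeff N g - coeff N (FK.eval xt) := by
          rw [hcoef]; ring
        calc coeff N x = (u * (Polynomial.derivative F).eval (constantCoeff x)) * coeff N x := by rw [hunit, one_mul]
          _ = u * ((Polynomial.derivative F).eval (constantCoeff x) * coeff N x) := by ring
          _ = u * (coeff N g - coeff N (FK.eval xt)) := by rw [e1]
      rw [key]
      exact Subring.mul_mem _ hu (Subring.sub_mem _ (hg N) h1)

end Literature.Computation.Certificates.BranchIntegrality
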